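import Mathlib
import HarnessLib
import Summits.MatrixMultiplication.MatrixMultiplication.Theorems.OutsiderSandwichToricCeilingPowMixedGlue
import Summits.MatrixMultiplication.MatrixMultiplication.Theorems.OutsiderSandwichToricCeilingPowSubTwo

/-!
# OutsiderSandwich — toric ceilings in MIXED product bases of `cw₂^{⊠N}`, part 2: THE STAR LEMMA
(decomp-mm lens 4, gen 46, kernel K46-2b; THESES-FREE, `ω`-free; helper toward `LaserTangency`,
stmt-32268 — the extremal subrank/packing cells of the literal host `kroneckerPow (cwTensor ℂ 2) N`)

LABEL.  TORIC · uniform in `N` · NEC-side instrument of the decomposition cell; the rates / the crux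
`h₁ = LaserTangency` and the route's `closes` are untouched.  This is the first of the three inputs
(stars · co-size-2 slices · `N = 2` base) of the mixed-basis analogue of K45
(`…ToricCeilingPowSubTwo`), see NODE-g46 (decomp-mm lens 4); by itself it decides no toric value.

WHAT.  `hasPM_star`: for EVERY `N` and every flag word `κ : Fin N → Bool` (product basis of
`cw₂^{⊠N}`, `true` = Coppersmith–Winograd basis, `false` = permutation basis) with AT MOST ONE cw
coordinate, the complement of any STAR `({x}, {y}, {z})` whose letters `xᵢ, yᵢ, zᵢ` are pairwise
distinct at every coordinate has a leg-injective perfect matching inside `frame κ` (`isPMκ`, part 1).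
Distinct letters is the right notion of star in every basis: a cw slot `(0,i,i), (i,0,i), (i,i,0)`
contains the letter `1` an even number of times and `3^N` is odd, so a complement `({x}, {y}, {z})`
with a repeated letter at a cw coordinate — e.g. the complement of a frame triple — has NO perfect
matching; for `κ ≡ false` the lemma is K45's translation class `isPM_star` (`hasPM_star_tight`).

THE ARGUMENT.  Induction on `N`, slicing at a permutation pivot `p` (part 1, `isPMκ_glue`) with
pivot letters `(a, a+2d, a+d)` of the star: primary direction `d`; the three slots
`(a', a'+d, a'+2d)` carry the STAR tail instances `(x', v₂, w₁)`, `(u₁, y', w₂)`, `(u₂, v₁, z')`,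
where `T₁ = (a+d, a, a+2d)·(u₁, v₁, w₁)` and `T₂ = (a+2d, a+d, a)·(u₂, v₂, w₂)` are two auxiliary
triples of direction `2d` whose tail letters are given coordinatewise by the STAR RULE `stAux`
(`st_spec`, a finite check over `Fin 3`: at a permutation coordinate `(z, x, y), (y, z, x)`; at a
cw coordinate a six-entry table).  Base: `N = 0` (empty matching) and the one-letter cw frame
(`star_cw_one`: two cw triples, table `cwBase`).  The star lemma is the input "slots `b`, `c` carry
stars" of the CROSSED and SPREAD slices of the mixed-basis induction (next parts).
All definitions are letter tables; no computation beyond `decide` over `Fin 3`; no new axioms.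
-/

set_option linter.dupNamespace false

namespace Summit.MatrixMultiplication.MatrixMultiplication.Theorems.OutsiderSandwichToricCeilingPowMixedStar

open Finset
open Summit.MatrixMultiplication.MatrixMultiplication.Theorems.OutsiderSandwichToricCeiling
  (cwSlot dSlot)
open Summit.MatrixMultiplication.MatrixMultiplication.Theorems.OutsiderSandwichToricCeilingPowFibres
  (Word Tr3 slotB frame)
open Summit.MatrixMultiplication.MatrixMultiplication.Theorems.OutsiderSandwichToricCeilingPowSubTwoGlue
open Summit.MatrixMultiplication.MatrixMultiplication.Theorems.OutsiderSandwichToricCeilingPowSubTwoRules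
open Summit.MatrixMultiplication.MatrixMultiplication.Theorems.OutsiderSandwichToricCeilingPowMixedGlue
open Summit.MatrixMultiplication.MatrixMultiplication.Theorems.OutsiderSandwichToricCeilingPowSubTwo
  (word_one_eq)

variable {m : ℕ}

/-! ## §1 The star rule (letter tables) -/

/-- THE STAR RULE at one tail coordinate with flag `b` and star letters `(x, y, z)`: the tail
letters `((u₁, v₁, w₁), (u₂, v₂, w₂))` of the two auxiliary triples.  Permutation coordinate:
`(z, x, y), (y, z, x)`; cw coordinate: a table. [new] -/
def stAux (b : Bool) (x y z : Fin 3) : (Fin 3 × Fin 3 × Fin 3) × (Fin 3 × Fin 3 × Fin 3) :=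
  if b then
    (if x = 0 then (if y = 1 then ((0, 1, 1), (0, 2, 2)) else ((0, 2, 2), (0, 1, 1)))
      else if x = 1 then (if y = 0 then ((1, 1, 0), (0, 2, 2)) else ((0, 2, 2), (1, 0, 1)))
      else (if y = 0 then ((2, 2, 0), (0, 1, 1)) else ((2, 2, 0), (1, 1, 0))))
  else ((z, x, y), (y, z, x))

/-- [new] -/ def stU₁ (b : Bool) (x y z : Fin 3) : Fin 3 := (stAux b x y z).1.1
/-- [new] -/ def stV₁ (b : Bool) (x y z : Fin 3) : Fin 3 := (stAux b x y z).1.2.1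
/-- [new] -/ def stW₁ (b : Bool) (x y z : Fin 3) : Fin 3 := (stAux b x y z).1.2.2
/-- [new] -/ def stU₂ (b : Bool) (x y z : Fin 3) : Fin 3 := (stAux b x y z).2.1
/-- [new] -/ def stV₂ (b : Bool) (x y z : Fin 3) : Fin 3 := (stAux b x y z).2.2.1
/-- [new] -/ def stW₂ (b : Bool) (x y z : Fin 3) : Fin 3 := (stAux b x y z).2.2.2

/-- The STAR local constraints, as a Boolean: both auxiliary rows lie in the slot of flag `b`, and
the three tail stars `(x, v₂, w₁)`, `(u₁, y, w₂)`, `(u₂, v₁, z)` have distinct letters. [new] -/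
def stGood (b : Bool) (x y z : Fin 3) : Bool :=
  slotB b (stU₁ b x y z) (stV₁ b x y z) (stW₁ b x y z) &&
  slotB b (stU₂ b x y z) (stV₂ b x y z) (stW₂ b x y z) &&
  decide ((x ≠ stV₂ b x y z ∧ stV₂ b x y z ≠ stW₁ b x y z ∧ x ≠ stW₁ b x y z) ∧
    (stU₁ b x y z ≠ y ∧ y ≠ stW₂ b x y z ∧ stU₁ b x y z ≠ stW₂ b x y z) ∧
    (stU₂ b x y z ≠ stV₁ b x y z ∧ stV₁ b x y z ≠ z ∧ stU₂ b x y z ≠ z))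

/-- The star rule meets its specification at every star letter configuration, in both bases
(finite check over `Fin 3`). -/
theorem st_spec_bool : ∀ (b : Bool) (x y z : Fin 3), x ≠ y → y ≠ z → x ≠ z →
    stGood b x y z = true := by
  decide

/-- THE STAR LOCAL LEMMA, unfolded. -/
theorem st_spec (b : Bool) (x y z : Fin 3) (h : x ≠ y ∧ y ≠ z ∧ x ≠ z) :
    slotB b (stU₁ b x y z) (stV₁ b x y z) (stW₁ b x y z) = true ∧
    slotB b (stU₂ b x y z) (stV₂ b x y z) (stW₂ b x y z) = true ∧
    (x ≠ stV₂ b x y z ∧ stV₂ b x y z ≠ stW₁ b x y z ∧ x ≠ stW₁ b x y z) ∧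
    (stU₁ b x y z ≠ y ∧ y ≠ stW₂ b x y z ∧ stU₁ b x y z ≠ stW₂ b x y z) ∧
    (stU₂ b x y z ≠ stV₁ b x y z ∧ stV₁ b x y z ≠ z ∧ stU₂ b x y z ≠ z) := by
  have H := st_spec_bool b x y z h.1 h.2.1 h.2.2
  simp only [stGood, Bool.and_eq_true, decide_eq_true_iff] at H
  exact ⟨H.1.1, H.1.2, H.2⟩

/-! ## §2 The star slice -/

/-- STAR CORE.  Pivot `p` in the permutation basis, star letters `(a, a+2d, a+d)` at the pivot
(`d ≠ 0`), tails with distinct letters; given a perfect matching of every distinct-letter star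
complement one level down (in the tail frame), the glue of primary direction `d` with the two
auxiliary triples `T₁ ∈ (a+d, a, a+2d)`, `T₂ ∈ (a+2d, a+d, a)` of the star rule is a perfect
matching of the complement of `({x}, {y}, {z})`. -/
theorem star_core {p : Fin (m + 1)} {κ : Fin (m + 1) → Bool} (hp : κ p = false)
    (ih : ∀ x y z : Word m, (∀ j, x j ≠ y j ∧ y j ≠ z j ∧ x j ≠ z j) →
      ∃ P, isPMκ (tailκ p κ) P {x} {y} {z} = true)
    {a d : Fin 3} (hd : d ≠ 0) {x y z : Word (m + 1)} (hX : x p = a) (hY : y p = a + d + d)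
    (hZ : z p = a + d) (h : ∀ j, tl p x j ≠ tl p y j ∧ tl p y j ≠ tl p z j ∧ tl p x j ≠ tl p z j) :
    ∃ P, isPMκ κ P {x} {y} {z} = true := by
  obtain ⟨n₁, n₂, n₃⟩ := F3.lift_ne a d hd
  have h3 : a + d + d + d = a := F3.add3 a d
  have H := fun j => st_spec (κ (p.succAbove j)) (tl p x j) (tl p y j) (tl p z j) (h j)
  -- tails of the auxiliary triples
  obtain ⟨u₁, hu₁⟩ : ∃ u₁ : Word m, u₁ = fun j =>
    stU₁ (κ (p.succAbove j)) (tl p x j) (tl p y j) (tl p z j) := ⟨_, rfl⟩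
  obtain ⟨v₁, hv₁⟩ : ∃ v₁ : Word m, v₁ = fun j =>
    stV₁ (κ (p.succAbove j)) (tl p x j) (tl p y j) (tl p z j) := ⟨_, rfl⟩
  obtain ⟨w₁, hw₁⟩ : ∃ w₁ : Word m, w₁ = fun j =>
    stW₁ (κ (p.succAbove j)) (tl p x j) (tl p y j) (tl p z j) := ⟨_, rfl⟩
  obtain ⟨u₂, hu₂⟩ : ∃ u₂ : Word m, u₂ = fun j =>
    stU₂ (κ (p.succAbove j)) (tl p x j) (tl p y j) (tl p z j) := ⟨_, rfl⟩
  obtain ⟨v₂, hv₂⟩ : ∃ v₂ : Word m, v₂ = fun j =>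
    stV₂ (κ (p.succAbove j)) (tl p x j) (tl p y j) (tl p z j) := ⟨_, rfl⟩
  obtain ⟨w₂, hw₂⟩ : ∃ w₂ : Word m, w₂ = fun j =>
    stW₂ (κ (p.succAbove j)) (tl p x j) (tl p y j) (tl p z j) := ⟨_, rfl⟩
  have F1 : ((u₁, v₁, w₁) : Tr3 m) ∈ frame (tailκ p κ) := by
    rw [mem_frame]; intro j; rw [hu₁, hv₁, hw₁]; exact (H j).1
  have F2 : ((u₂, v₂, w₂) : Tr3 m) ∈ frame (tailκ p κ) := by
    rw [mem_frame]; intro j; rw [hu₂, hv₂, hw₂]; exact (H j).2.1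
  have S0 : ∀ j, tl p x j ≠ v₂ j ∧ v₂ j ≠ w₁ j ∧ tl p x j ≠ w₁ j := fun j => by
    rw [hv₂, hw₁]; exact (H j).2.2.1
  have S1 : ∀ j, u₁ j ≠ tl p y j ∧ tl p y j ≠ w₂ j ∧ u₁ j ≠ w₂ j := fun j => by
    rw [hu₁, hw₂]; exact (H j).2.2.2.1
  have S2 : ∀ j, u₂ j ≠ v₁ j ∧ v₁ j ≠ tl p z j ∧ u₂ j ≠ tl p z j := fun j => by
    rw [hu₂, hv₁]; exact (H j).2.2.2.2
  -- the three sub-matchings (stars one level down)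
  obtain ⟨Q₀, hQ₀⟩ := ih (tl p x) v₂ w₁ S0
  obtain ⟨Q₁, hQ₁⟩ := ih u₁ (tl p y) w₂ S1
  obtain ⟨Q₂, hQ₂⟩ := ih u₂ v₁ (tl p z) S2
  -- the auxiliary triples
  obtain ⟨T₁, hT₁⟩ : ∃ T₁ : Tr3 (m + 1), T₁ = (ins p (a + d) u₁, ins p a v₁, ins p (a + d + d) w₁) :=
    ⟨_, rfl⟩
  obtain ⟨T₂, hT₂⟩ : ∃ T₂ : Tr3 (m + 1), T₂ = (ins p (a + d + d) u₂, ins p (a + d) v₂, ins p a w₂) :=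
    ⟨_, rfl⟩
  refine ⟨glue p d {T₁, T₂} fun a' => if a' = a then Q₀ else if a' = a + d then Q₁ else Q₂,
    isPMκ_glue hp hd ?_ ?_ ?_ ?_ ?_ ?_ ?_ ?_⟩
  · intro t ht
    simp only [mem_insert, mem_singleton] at ht
    rcases ht with rfl | rfl
    · rw [hT₁]; exact (mk3_mem_frame hp).2 ⟨⟨n₁.symm, n₃, n₂⟩, F1⟩
    · rw [hT₂]; exact (mk3_mem_frame hp).2 ⟨⟨n₂.symm, n₁.symm, n₃.symm⟩, F2⟩
  · exact injOn_pair fun e => by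
      rw [hT₁, hT₂] at e; simp only [ins_inj] at e; exact absurd e.1 n₂
  · exact injOn_pair fun e => by
      rw [hT₁, hT₂] at e; simp only [ins_inj] at e; exact absurd e.1 n₁
  · exact injOn_pair fun e => by
      rw [hT₁, hT₂] at e; simp only [ins_inj] at e; exact absurd e.1 n₃.symm
  · intro t ht
    simp only [mem_insert, mem_singleton] at ht
    rcases ht with rfl | rfl
    · rw [hT₁]; simp [ins_eq_iff, hX, n₁.symm]
    · rw [hT₂]; simp [ins_eq_iff, hX, n₃.symm]
  · intro t ht
    simp only [mem_insert, mem_singleton] at ht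
    rcases ht with rfl | rfl
    · rw [hT₁]; simp [ins_eq_iff, hY, n₃]
    · rw [hT₂]; simp [ins_eq_iff, hY, n₂]
  · intro t ht
    simp only [mem_insert, mem_singleton] at ht
    rcases ht with rfl | rfl
    · rw [hT₁]; simp [ins_eq_iff, hZ, n₂.symm]
    · rw [hT₂]; simp [ins_eq_iff, hZ, n₁]
  · intro a'
    rcases F3.cases3 a d a' hd with rfl | rfl | rfl
    · have e1 : layer p a' ({x} ∪ ({T₁, T₂} : Finset (Tr3 (m + 1))).image (fun t => t.1))
          = {tl p x} := by
        ext u; simp [hT₁, hT₂, ins_eq_iff, hX, n₁, n₃]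
      have e2 : layer p (a' + d) ({y} ∪ ({T₁, T₂} : Finset (Tr3 (m + 1))).image
          (fun t => t.2.1)) = {v₂} := by
        ext u; simp [hT₁, hT₂, ins_eq_iff, hY, n₂, n₁.symm]
      have e3 : layer p (a' + d + d) ({z} ∪ ({T₁, T₂} : Finset (Tr3 (m + 1))).image
          (fun t => t.2.2)) = {w₁} := by
        ext u; simp [hT₁, hT₂, ins_eq_iff, hZ, n₂.symm, n₃.symm]
      rw [e1, e2, e3, if_pos rfl]
      exact hQ₀
    · have e1 : layer p (a + d) ({x} ∪ ({T₁, T₂} : Finset (Tr3 (m + 1))).image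
          (fun t => t.1)) = {u₁} := by
        ext u; simp [hT₁, hT₂, ins_eq_iff, hX, n₁.symm, n₂]
      have e2 : layer p (a + d + d) ({y} ∪ ({T₁, T₂} : Finset (Tr3 (m + 1))).image
          (fun t => t.2.1)) = {tl p y} := by
        ext u; simp [hT₁, hT₂, ins_eq_iff, hY, n₃.symm, n₂.symm]
      have e3 : layer p (a + d + d + d) ({z} ∪ ({T₁, T₂} : Finset (Tr3 (m + 1))).image
          (fun t => t.2.2)) = {w₂} := by
        ext u; simp [hT₁, hT₂, ins_eq_iff, hZ, h3, n₁, n₃]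
      rw [e1, e2, e3, if_neg n₁.symm, if_pos rfl]
      exact hQ₁
    · have e1 : layer p (a + d + d) ({x} ∪ ({T₁, T₂} : Finset (Tr3 (m + 1))).image
          (fun t => t.1)) = {u₂} := by
        ext u; simp [hT₁, hT₂, ins_eq_iff, hX, n₃.symm, n₂.symm]
      have e2 : layer p (a + d + d + d) ({y} ∪ ({T₁, T₂} : Finset (Tr3 (m + 1))).image
          (fun t => t.2.1)) = {v₁} := by
        ext u; simp [hT₁, hT₂, ins_eq_iff, hY, h3, n₃, n₁]
      have e3 : layer p (a + d + d + d + d) ({z} ∪ ({T₁, T₂} : Finset (Tr3 (m + 1))).image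
          (fun t => t.2.2)) = {tl p z} := by
        ext u; simp [hT₁, hT₂, ins_eq_iff, hZ, h3, n₂, n₁.symm]
      rw [e1, e2, e3, if_neg n₃.symm, if_neg n₂.symm]
      exact hQ₂

/-- STAR SLICE at a permutation pivot `p`: orientation of the pivot letters, then the core. -/
theorem star_slice {p : Fin (m + 1)} {κ : Fin (m + 1) → Bool} (hp : κ p = false)
    (ih : ∀ x y z : Word m, (∀ j, x j ≠ y j ∧ y j ≠ z j ∧ x j ≠ z j) →
      ∃ P, isPMκ (tailκ p κ) P {x} {y} {z} = true)
    {x y z : Word (m + 1)} (h : ∀ i, x i ≠ y i ∧ y i ≠ z i ∧ x i ≠ z i) :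
    ∃ P, isPMκ κ P {x} {y} {z} = true := by
  obtain ⟨hd, hZ, hY, -, -⟩ := F3.third (x p) (z p) (y p) (h p).2.2 (h p).2.1.symm (h p).1
  exact star_core hp ih hd rfl hY.symm hZ.symm fun j => h (p.succAbove j)

/-! ## §3 Base cases and the star lemma -/

/-- `N = 0`: the complement of a star is empty, and so is its matching. -/
theorem star_zero (κ : Fin 0 → Bool) (x y z : Word 0) : isPMκ κ ∅ {x} {y} {z} = true := by
  rw [isPMκ_iff]
  have j : ∀ f : Tr3 0 → Word 0, Set.InjOn f ((∅ : Finset (Tr3 0)) : Set (Tr3 0)) :=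
    fun f s hs => by simp at hs
  refine ⟨empty_subset _, j _, j _, j _, ?_, ?_, ?_⟩ <;>
  · rw [image_empty, eq_comm, sdiff_eq_empty_iff_subset]
    intro w _
    exact mem_singleton.2 (Subsingleton.elim _ _)

/-- In `Word 1`, the two constant words on the letters other than `w 0` form the complement of
`{w}`. -/
theorem word₁_pair_compl (ξ α β : Fin 3) (w : Word 1) (hw : w 0 = ξ) (h₁ : α ≠ ξ) (h₂ : β ≠ ξ)
    (h₃ : α ≠ β) : ({(fun _ => α : Word 1), (fun _ => β : Word 1)} : Finset (Word 1)) = univ \ {w} := by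
  ext u
  simp only [mem_insert, mem_singleton, mem_sdiff, mem_univ, true_and]
  constructor
  · rintro (rfl | rfl) e
    · exact h₁ (hw ▸ (congrFun e 0))
    · exact h₂ (hw ▸ (congrFun e 0))
  · intro hu
    have hu0 : u 0 ≠ ξ := fun e => hu (word_one_eq (e.trans hw.symm))
    rcases F3.cover ξ α β (u 0) h₁.symm h₃ h₂.symm with e | e | e
    · exact absurd e hu0
    · exact Or.inl (word_one_eq e)
    · exact Or.inr (word_one_eq e)

/-- THE ONE-LETTER CW BASE TABLE: for star letters `(x, y, z)`, the letters of the two cw triples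
covering the complement. [new] -/
def cwBase (x y : Fin 3) : (Fin 3 × Fin 3 × Fin 3) × (Fin 3 × Fin 3 × Fin 3) :=
  if x = 0 then (if y = 1 then ((1, 0, 1), (2, 2, 0)) else ((1, 1, 0), (2, 0, 2)))
  else if x = 1 then (if y = 0 then ((0, 1, 1), (2, 2, 0)) else ((0, 1, 1), (2, 0, 2)))
  else (if y = 0 then ((0, 2, 2), (1, 1, 0)) else ((0, 2, 2), (1, 0, 1)))

/-- [new] -/ def cbA₁ (x y : Fin 3) : Fin 3 := (cwBase x y).1.1
/-- [new] -/ def cbB₁ (x y : Fin 3) : Fin 3 := (cwBase x y).1.2.1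
/-- [new] -/ def cbC₁ (x y : Fin 3) : Fin 3 := (cwBase x y).1.2.2
/-- [new] -/ def cbA₂ (x y : Fin 3) : Fin 3 := (cwBase x y).2.1
/-- [new] -/ def cbB₂ (x y : Fin 3) : Fin 3 := (cwBase x y).2.2.1
/-- [new] -/ def cbC₂ (x y : Fin 3) : Fin 3 := (cwBase x y).2.2.2

/-- The cw base table is correct: two cw rows, with distinct letters legwise, avoiding the star
letters (finite check over `Fin 3`). -/
theorem cwBase_spec : ∀ x y z : Fin 3, x ≠ y → y ≠ z → x ≠ z →
    cwSlot (cbA₁ x y) (cbB₁ x y) (cbC₁ x y) = true ∧ cwSlot (cbA₂ x y) (cbB₂ x y) (cbC₂ x y) = true ∧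
    (cbA₁ x y ≠ x ∧ cbA₂ x y ≠ x ∧ cbA₁ x y ≠ cbA₂ x y) ∧
    (cbB₁ x y ≠ y ∧ cbB₂ x y ≠ y ∧ cbB₁ x y ≠ cbB₂ x y) ∧
    (cbC₁ x y ≠ z ∧ cbC₂ x y ≠ z ∧ cbC₁ x y ≠ cbC₂ x y) := by
  decide

/-- BASE: the one-letter cw frame.  The complement of a star with distinct letters is matched by
the two cw triples of `cwBase`. -/
theorem star_cw_one (x y z : Word 1) (h : ∀ i, x i ≠ y i ∧ y i ≠ z i ∧ x i ≠ z i) :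
    ∃ P, isPMκ (fun _ : Fin 1 => true) P {x} {y} {z} = true := by
  obtain ⟨c₁, c₂, hA, hB, hC⟩ := cwBase_spec (x 0) (y 0) (z 0) (h 0).1 (h 0).2.1 (h 0).2.2
  refine ⟨{((fun _ => cbA₁ (x 0) (y 0)), (fun _ => cbB₁ (x 0) (y 0)), (fun _ => cbC₁ (x 0) (y 0))),
    ((fun _ => cbA₂ (x 0) (y 0)), (fun _ => cbB₂ (x 0) (y 0)), (fun _ => cbC₂ (x 0) (y 0)))},
    isPMκ_iff.2 ⟨?_, ?_, ?_, ?_, ?_, ?_, ?_⟩⟩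
  · intro t ht
    simp only [mem_insert, mem_singleton] at ht
    rcases ht with rfl | rfl <;> (rw [mem_frame]; intro i; simpa [slotB])
  · exact injOn_pair fun e => absurd (congrFun e 0) hA.2.2
  · exact injOn_pair fun e => absurd (congrFun e 0) hB.2.2
  · exact injOn_pair fun e => absurd (congrFun e 0) hC.2.2
  · rw [image_insert, image_singleton]
    exact word₁_pair_compl (x 0) _ _ x rfl hA.1 hA.2.1 hA.2.2
  · rw [image_insert, image_singleton]
    exact word₁_pair_compl (y 0) _ _ y rfl hB.1 hB.2.1 hB.2.2
  · rw [image_insert, image_singleton]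
    exact word₁_pair_compl (z 0) _ _ z rfl hC.1 hC.2.1 hC.2.2

/-- **THE STAR LEMMA** (all `N`; every product basis with at most one cw coordinate).  The
complement of a star `({x}, {y}, {z})` with pairwise distinct letters at every coordinate has a
leg-injective perfect matching inside `frame κ`.  Induction on `N`: slice at a permutation pivot
(`star_slice`) if there is one; otherwise `N ≤ 1` and the one-letter cw table applies. -/
theorem hasPM_star : ∀ (m : ℕ) (κ : Fin m → Bool), (∀ i j, κ i = true → κ j = true → i = j) →
    ∀ x y z : Word m, (∀ i, x i ≠ y i ∧ y i ≠ z i ∧ x i ≠ z i) →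
      ∃ P, isPMκ κ P {x} {y} {z} = true := by
  intro m
  induction m with
  | zero => exact fun κ _ x y z _ => ⟨∅, star_zero κ x y z⟩
  | succ m IH =>
    intro κ hκ x y z h
    by_cases hD : ∃ p, κ p = false
    · obtain ⟨p, hp⟩ := hD
      exact star_slice hp (IH (tailκ p κ) (tailκ_atMostOne hκ)) h
    · push Not at hD
      have hall : ∀ i, κ i = true := fun i => by simpa using hD i
      rcases Nat.eq_zero_or_pos m with hm | hm
      · subst hm
        obtain rfl : κ = fun _ => true := funext hall
        exact star_cw_one x y z h
      · exact absurd (hκ ⟨0, by omega⟩ ⟨1, by omega⟩ (hall _) (hall _)) (by simp)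

/-- The star lemma in the all-permutation basis is K45's translation class (consistency check; not
used). -/
theorem hasPM_star_tight (x y z : Word m) (h : ∀ i, x i ≠ y i ∧ y i ≠ z i ∧ x i ≠ z i) :
    ∃ P, isPMκ (fun _ : Fin m => false) P {x} {y} {z} = true :=
  ⟨_, (isPMκ_tight _ _ _ _).trans (isPM_star x y z h)⟩

end Summit.MatrixMultiplication.MatrixMultiplication.Theorems.OutsiderSandwichToricCeilingPowMixedStar
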